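import Mathlib.GroupTheory.PGroup
import Mathlib.NumberTheory.Padics.RingHoms
import Literature.NumberTheory.EllipticCurves.Sprung2012.ColemanMapImage
import Literature.NumberTheory.EllipticCurves.TateModuleBaseChange
import Literature.NumberTheory.EllipticCurves.SelmerCorankProofs
import Literature.NumberTheory.EllipticCurves.GaloisActionProofs
import Literature.NumberTheory.EllipticCurves.LocalPointsPlaceTransportProofs
import Literature.NumberTheory.EllipticCurves.LocalTorsionGoodReductionProofs
import Literature.NumberTheory.GaloisRepresentations.AbsGaloisGroupCompact
import HarnessLib

/-!
# Sprung 2012, Lemma 2.3 — `E(ℚ_∞·ℚ_p)` has no `p`-torsion at a supersingular `p ≠ 2` — DISCHARGED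

`Proofs` file (theorems only; no definition, no named fact; net Literature debt `−1`) for the named
fact `Literature.NumberTheory.EllipticCurves.Sprung2012.lem23_localTowerPoints_noPTorsion` of
`Sprung2012/ColemanMapImage.lean`: F. E. I. Sprung, *Iwasawa theory for elliptic curves at
supersingular primes: A pair of main conjectures*, J. Number Theory **132** (2012) 1483–1506
[Sprung2012], Lemma 2.3 (p. 1487): "`F_ss(k_n)` has no `p`-torsion", with the supersingular remark of
the proof of Prop. 7.3 (p. 1500: "the cokernel `Ẽ(𝔽_p)` of `Ê(k_0) → E(k_0)` having no
`p`-torsion, since `p` is supersingular"), read — as the fact reads it — on the points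
`E(ℚ_∞·ℚ_p) = localTowerPointsOfEmb κ ι W` of `W/ℚ` over `K̄_v` (`v ∋ p`, `ι = closureEmb`) fixed by
`Gal(K̄_v/ℚ_∞·ℚ_v) = localSubgroupOfEmb κ.kerSubgroup ι`, `κ` a (the cyclotomic) `ℤ_p`-extension of
`ℚ`: **every `P ∈ E(ℚ_∞·ℚ_p)` with `p • P = O` is `O`** (= [Sprung2024] §5.2, proof of Lemma 5.5,
p. 40: "`H⁰(k_n, V/T) = 0` … by [64, Lemma 2.3]").

## The proof (Greenberg's fixed-point principle, LNM 1716 proof of Prop. 4.8, p. 109, in place of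
## the printed ramification count "`p² − 1 ∤ deg(k_n/ℚ_p)`"; same statement)

This is the LOCAL twin of the tree's `WeierstrassCurve.fixedPoints_kerSubgroup_geomPrimaryTorsion_eq_bot`
(`IwasawaTorsionTowerProofs`: `E(K)[p] = 0 ⇒ E(K_∞)[p^∞] = 0` for a `ℤ_p`-extension of a number
field), run over the completion `ℚ_v`:

1. `V := E(ℚ_∞·ℚ_p)[p]` is finite (`#E(K̄_v)[p] = p²`, `WeierstrassCurve.card_torsionPoints_eq_sq_holds`)
   and `Γ_{ℚ_v}`-stable (`Sprung2012.smul_mem_localTowerPointsOfEmb`); `Γ_{ℚ_v}` acts on it through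
   `ρ : Γ_{ℚ_v} →* Perm V`, trivially on `Gal(K̄_v/ℚ_∞·ℚ_v)`.
2. **The range of `ρ` is a `p`-group** (`ZpExtension.isPGroup_range_of_localSubgroupOfEmb_le`, the
   local twin of `ZpExtension.isPGroup_range_of_kerSubgroup_le`): the image `κ(res Γ_{ℚ_v}) ⊆ ℤ_p` is
   compact (`absoluteGaloisGroup_compactSpace`; `κ`, `resGalOfEmb` continuous), hence closed, hence
   stable under multiplication by `ℤ_p` (`ℕ` is dense, `PadicInt.denseRange_natCast`); so for
   `#Perm(V) = p^a·m`, `p ∤ m`, every `σ` satisfies `σ ≡ τ^m (mod Gal(K̄_v/ℚ_∞·ℚ_v))` for some `τ`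
   (`m ∈ ℤ_pˣ`), whence `ρ(σ)^{p^a} = ρ(τ)^{#Perm V} = 1`.
3. `#V ≡ #V^{Γ_{ℚ_v}} (mod p)` (Mathlib `IsPGroup.card_modEq_card_fixedPoints`), and
   **`V^{Γ_{ℚ_v}} ⊆ E(ℚ_v)[p] = 0`**: a `Γ_{ℚ_v}`-fixed point of `E(K̄_v)` is `ℚ_v`-rational (Galois
   descent `WeierstrassCurve.exists_toGeomPoints_eq_of_forall_smul_eq` along
   `localPointsEquivBaseChange`), and `E(ℚ_v)[p] = E(ℚ_p)[p] = 0`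
   (`WeierstrassCurve.forall_nsmul_eq_zero_adicCompletion_iff_padic` with the tree's
   `localTorsion_eq_zero_of_good_of_not_dvd_frobeniusTrace_sub_one`, Silverman VII.2.1/VII.3.1/IV.6.1:
   `p ≥ 3` good and `p ∤ a_p − 1` — a supersingular `p ∣ a_p` is not anomalous; this is the printed
   "`#Ẽ(𝔽_p) = p + 1 − a_p ≡ 1 (mod p)`" together with "`Ê(ℚ_p)` has no `p`-torsion").
4. `#V` is a power of `p` (`V` is killed by `p`), so `#V = 1` and `V = 0`.

The hypothesis `κ.IsCyclotomic` of the fact is not used (the statement holds for every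
`ℤ_p`-extension of `ℚ`); `p ≠ 2` is used only through `p ≥ 3` in Silverman IV.6.1.

WHY (cell `pub/bsd-cited`, ARM P reader `bsd-cited-r18`, base-role discharge; fact typed by
`bsd-ssimc-k3c5-kdot-split` g6 for «KDOT-L55-KERNEL»): with this file the `v = p` clause of
Sprung 2024 Lemma 5.5 (`Sprung2024.lem55[AllN]_…`) is a kernel theorem modulo Sprung 2012
Props. 7.3 / 7.6 only. HONEST FRAMING: a local torsion statement; nothing about any census cell;
BSD is not proved by any of this.

## References
* [Sprung2012] F. Sprung, J. Number Theory 132 (2012), Lemma 2.3 (p. 1487); proof of Prop. 7.3 (p. 1500).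
* [Sprung2024] F. Sprung, Adv. Math. 449 (2024) 109741, §5.2, proof of Lemma 5.5 (p. 40).
* [GreenbergLNM1716] R. Greenberg, *Iwasawa theory for elliptic curves*, LNM 1716 (1999), proof of
  Prop. 4.8 (p. 109) (a pro-`p` group acting on a non-zero finite `p`-group has a non-zero fixed point).
* [SilvermanAEC2009] J. H. Silverman, *The Arithmetic of Elliptic Curves*, 2nd ed., VII.2.1,
  VII.3.1, IV.6.1.

## Design
Theorems only. As in `IwasawaTowerTorsionProofs`, the permutation action on the finite set `V` is an
explicit homomorphism `Γ_{ℚ_v} →* Equiv.Perm V` built inside the proof; no `MulAction` instance on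
an auxiliary type is declared.
-/

noncomputable section

open scoped Classical NumberField AddSubgroup

open NumberField IsDedekindDomain WeierstrassCurve Literature.NumberTheory.EllipticCurves
  Literature.NumberTheory.EllipticCurves.ZpExtension

universe u

/-! ## §1 A finite image of `Γ_{K_v}` that kills `Gal(K̄_v/K_∞·K_v)` is a `p`-group -/

namespace Literature.NumberTheory.EllipticCurves.ZpExtension

variable {K : Type u} [Field K] {p : ℕ} [Fact p.Prime] (κ : ZpExtension K p)
  {E : Type u} [Field E] [Algebra K E] (ι : AlgebraicClosure K →ₐ[K] AlgebraicClosure E)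

/-- The additive image `κ(res_ι Γ_E) ⊆ ℤ_p` of the local Galois group is stable under
multiplication by `ℤ_p`: it is compact (`Γ_E` is compact, `κ ∘ res_ι` continuous), hence closed,
and contains `n · κ(res σ) = κ(res σⁿ)` for every `n : ℕ`, a dense set of multiples
(`PadicInt.denseRange_natCast`). (Every closed subgroup of `ℤ_p` is an ideal `pⁿℤ_p` or `0`:
Washington, *Introduction to Cyclotomic Fields*, §13.1.) [cite: Washington1997, §13.1] -/
theorem exists_toAdd_kappa_resGalOfEmb_eq_mul (c : ℤ_[p]) (σ : Field.absoluteGaloisGroup E) :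
    ∃ τ : Field.absoluteGaloisGroup E,
      (κ (resGalOfEmb ι τ)).toAdd = c * (κ (resGalOfEmb ι σ)).toAdd := by
  haveI : CompactSpace (Field.absoluteGaloisGroup E) :=
    Literature.NumberTheory.GaloisRepresentations.absoluteGaloisGroup_compactSpace E
  -- the image as a subset of `ℤ_p`
  let a : Field.absoluteGaloisGroup E → ℤ_[p] := fun τ ↦ (κ (resGalOfEmb ι τ)).toAdd
  have ha : Continuous a :=
    continuous_toAdd.comp ((map_continuous κ).comp (map_continuous (resGalOfEmb ι)))
  have hS : IsClosed (Set.range a) := (isCompact_range ha).isClosed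
  -- `n · a σ = a (σ ^ n)` lies in the image
  have hnat : ∀ n : ℕ, (n : ℤ_[p]) * a σ ∈ Set.range a := fun n ↦ ⟨σ ^ n, by
    change (κ (resGalOfEmb ι (σ ^ n))).toAdd = (n : ℤ_[p]) * (κ (resGalOfEmb ι σ)).toAdd
    rw [map_pow, map_pow, toAdd_pow, nsmul_eq_mul]⟩
  -- the set of good multipliers is closed and contains the dense set `ℕ`
  let T : Set ℤ_[p] := {c | c * a σ ∈ Set.range a}
  have hT : IsClosed T := hS.preimage (continuous_id.mul continuous_const)
  have hsub : Set.range (Nat.cast : ℕ → ℤ_[p]) ⊆ T := by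
    rintro _ ⟨n, rfl⟩
    exact hnat n
  have hc : c ∈ T := hT.closure_subset_iff.mpr hsub (PadicInt.denseRange_natCast c)
  obtain ⟨τ, hτ⟩ := hc
  exact ⟨τ, hτ⟩

/-- **A finite image of `Γ_{K_v}` that kills `Gal(K̄_v/K_∞·K_v)` is a `p`-group** — the local twin
of `isPGroup_range_of_kerSubgroup_le` (`IwasawaTowerTorsionProofs`). If
`ρ : Γ_E → Perm(V)`, `V` finite, is trivial on `localSubgroupOfEmb κ.kerSubgroup ι` (the preimage of
`Gal(K̄/K_∞) = ker κ` under the restriction `res_ι : Γ_E → Γ_K`), then every element of its range has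
`p`-power order: with `#Perm(V) = p^a · m`, `p ∤ m`, the integer `m` is a unit of `ℤ_p` and the
image `κ(res_ι Γ_E)` is `ℤ_p`-stable (`exists_toAdd_kappa_resGalOfEmb_eq_mul`), so
`σ ≡ τ^m (mod localSubgroupOfEmb κ.kerSubgroup ι)` for some `τ ∈ Γ_E`, whence
`ρ(σ)^{p^a} = ρ(τ)^{#Perm(V)} = 1`. (Every finite quotient of a closed subgroup of `ℤ_p` is a cyclic
`p`-group; Washington, *Introduction to Cyclotomic Fields*, §13.1; the fixed-point principle it
feeds is Greenberg, LNM 1716, proof of Prop. 4.8, p. 109.) [cite: Washington1997, §13.1]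
[cite: GreenbergLNM1716, proof of Prop. 4.8 (p. 109)] -/
theorem isPGroup_range_of_localSubgroupOfEmb_le {V : Type*} [Finite V]
    (ρ : Field.absoluteGaloisGroup E →* Equiv.Perm V)
    (hρ : localSubgroupOfEmb κ.kerSubgroup ι ≤ ρ.ker) : IsPGroup p ρ.range := by
  have hp : p.Prime := Fact.out
  have hn0 : Nat.card (Equiv.Perm V) ≠ 0 := Nat.card_pos.ne'
  obtain ⟨a, m, hm, hnm⟩ := Nat.exists_eq_pow_mul_and_not_dvd hn0 p hp.ne_one
  -- `m` is a unit of `ℤ_p`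
  have hmu : IsUnit (m : ℤ_[p]) := by
    rw [PadicInt.isUnit_iff]
    refine le_antisymm (PadicInt.norm_le_one _) (not_lt.mp fun hlt ↦ hm ?_)
    have h := (PadicInt.norm_int_lt_one_iff_dvd (m : ℤ)).mp (by exact_mod_cast hlt)
    exact_mod_cast h
  obtain ⟨u, hu⟩ := hmu
  rintro ⟨g, σ, rfl⟩
  refine ⟨a, ?_⟩
  -- `τ` with `m · κ(res τ) = κ(res σ)`
  obtain ⟨τ, hτ⟩ := κ.exists_toAdd_kappa_resGalOfEmb_eq_mul ι ((u⁻¹ : ℤ_[p]ˣ) : ℤ_[p]) σ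
  have hτm : κ (resGalOfEmb ι (τ ^ m)) = κ (resGalOfEmb ι σ) := by
    apply Multiplicative.toAdd.injective
    rw [map_pow, map_pow, toAdd_pow, nsmul_eq_mul, hτ, ← mul_assoc, ← hu, Units.mul_inv, one_mul]
  have hk : (τ ^ m)⁻¹ * σ ∈ localSubgroupOfEmb κ.kerSubgroup ι := by
    rw [mem_localSubgroupOfEmb_iff, mem_kerSubgroup, map_mul, map_inv, map_mul, map_inv, hτm,
      inv_mul_cancel]
  have hρσ : ρ σ = ρ τ ^ m := by
    have h1 : ρ ((τ ^ m)⁻¹ * σ) = 1 := hρ hk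
    rw [map_mul, map_inv, inv_mul_eq_one, map_pow] at h1
    exact h1.symm
  apply Subtype.ext
  change (ρ σ) ^ p ^ a = 1
  rw [hρσ, ← pow_mul, mul_comm, ← hnm]
  exact pow_card_eq_one'

end Literature.NumberTheory.EllipticCurves.ZpExtension

/-! ## §2 `Γ_{ℚ_v}`-fixed `p`-torsion of `E(K̄_v)` vanishes at a good non-anomalous `p ≥ 3` -/

namespace Literature.NumberTheory.EllipticCurves.Sprung2012

variable (W : WeierstrassCurve ℚ) [W.IsElliptic] [W.IsGloballyMinimal] (p : ℕ) [Fact p.Prime]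
  {v : HeightOneSpectrum (𝓞 ℚ)}

/-- **`E(K̄_v)^{Γ_{ℚ_v}}[p] = E(ℚ_v)[p] = E(ℚ_p)[p] = 0` at a good supersingular `p ≥ 3`.** For
`W/ℚ` elliptic and globally minimal, `p ≠ 2` of good reduction with `p ∣ a_p`, and the place
`v ∋ p`: a point of `E(K̄_v)` (`localPoints W ℚ_v`) fixed by all of `Γ_{ℚ_v}` and killed by `p` is
`O`. Galois descent to `E(ℚ_v)` (`exists_toGeomPoints_eq_of_forall_smul_eq` along
`localPointsEquivBaseChange`), transport `E(ℚ_v) ≅ E(ℚ_p)`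
(`forall_nsmul_eq_zero_adicCompletion_iff_padic`), and `E(ℚ_p)[p] = 0` at a good `p ≥ 3` with
`p ∤ a_p − 1` (`localTorsion_eq_zero_of_good_of_not_dvd_frobeniusTrace_sub_one`, Silverman VII.2.1 /
VII.3.1 / IV.6.1) — a supersingular prime is not anomalous. This is the sentence "the cokernel
`Ẽ(𝔽_p)` of `Ê(k_0) → E(k_0)` having no `p`-torsion, since `p` is supersingular" of the proof of
Prop. 7.3 together with the level-`0` case of Lemma 2.3.
[cite: Sprung2012, Lemma 2.3 (p. 1487) and proof of Prop. 7.3 (p. 1500)]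
[cite: SilvermanAEC2009, VII.2 Prop. 2.1, VII.3 Prop. 3.1 (with IV.6 Thm. 6.1)] -/
theorem localPoints_eq_zero_of_forall_smul_eq_of_prime_nsmul (hp2 : p ≠ 2)
    (hgood : W.HasGoodReductionAtPrime p) (hap : (p : ℤ) ∣ W.frobeniusTrace p)
    (hpv : (p : 𝓞 ℚ) ∈ v.asIdeal) {P : localPoints W (v.adicCompletion ℚ)}
    (hfix : ∀ σ : Field.absoluteGaloisGroup (v.adicCompletion ℚ), σ • P = P) (hpP : p • P = 0) :
    P = 0 := by
  have hp : p.Prime := Fact.out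
  -- `ℚ_v` is perfect (characteristic zero); no `CharZero` instance is left in the context, so that
  -- `Algebra ℚ ℚ_v` keeps resolving to the adic-completion algebra structure
  haveI : PerfectField (v.adicCompletion ℚ) := by
    haveI : CharZero (v.adicCompletion ℚ) :=
      charZero_of_injective_algebraMap (algebraMap ℚ _).injective
    infer_instance
  -- `p ≥ 3` and `p` is not anomalous
  have hp3 : 3 ≤ p := by
    have h2 := hp.two_le
    omega
  have hna : ¬ (p : ℤ) ∣ W.frobeniusTrace p - 1 := by
    intro h
    have h1 : (p : ℤ) ∣ 1 := by
      have := dvd_sub hap h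
      rwa [sub_sub_cancel] at this
    have : (p : ℤ) = 1 := Int.eq_one_of_dvd_one (by positivity) h1
    exact hp.one_lt.ne' (by exact_mod_cast this)
  -- `E(ℚ_v)[p] = 0`
  have hv0 : ∀ Q : (W.baseChange (v.adicCompletion ℚ)).toAffine.Point, p • Q = 0 → Q = 0 :=
    (W.forall_nsmul_eq_zero_adicCompletion_iff_padic hpv p).mpr
      (localTorsion_eq_zero_of_good_of_not_dvd_frobeniusTrace_sub_one W p hp3 hgood hna)
  -- descent: `P` is `ℚ_v`-rational
  set Q : geomPoints (W.baseChange (v.adicCompletion ℚ)) :=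
    localPointsEquivBaseChange W (v.adicCompletion ℚ) P with hQdef
  have hQ : ∀ σ : Field.absoluteGaloisGroup (v.adicCompletion ℚ), σ • Q = Q := fun σ ↦ by
    rw [hQdef, ← localPointsEquivBaseChange_smul W (v.adicCompletion ℚ) σ P, hfix σ]
  obtain ⟨P₀, hP₀⟩ :=
    WeierstrassCurve.exists_toGeomPoints_eq_of_forall_smul_eq (W.baseChange (v.adicCompletion ℚ)) hQ
  have hP₀p : p • P₀ = 0 := by
    apply WeierstrassCurve.toGeomPoints_injective (W.baseChange (v.adicCompletion ℚ))
    rw [map_nsmul, hP₀, map_zero, hQdef, ← map_nsmul, hpP, map_zero]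
  have hP₀0 : P₀ = 0 := hv0 P₀ hP₀p
  have hQ0 : Q = 0 := by rw [← hP₀, hP₀0, map_zero]
  exact (localPointsEquivBaseChange W (v.adicCompletion ℚ)).injective (by rw [← hQdef, hQ0, map_zero])

/-! ## §3 The discharge -/

/-- **`E(ℚ_∞·ℚ_p)[p] = 0` at a good supersingular `p ≠ 2`, for ANY embedding `ι : ℚ̄ → K̄_v` and
ANY `ℤ_p`-extension `κ` of `ℚ`**: a point of `E(K̄_v)` fixed by
`Gal(K̄_v/ℚ_∞·ℚ_v) = localSubgroupOfEmb κ.kerSubgroup ι` (`P ∈ localTowerPointsOfEmb κ ι W`) and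
killed by `p` is `O`. Proof: Greenberg's fixed-point principle (module docstring, steps 1–4):
`V = E(ℚ_∞·ℚ_p)[p]` is a finite `p`-group on which `Γ_{ℚ_v}` acts through a `p`-group
(`isPGroup_range_of_localSubgroupOfEmb_le`), its fixed points lie in `E(ℚ_v)[p] = 0`
(`localPoints_eq_zero_of_forall_smul_eq_of_prime_nsmul`), so `#V ≡ 1 (mod p)` and `V = 0`.
[cite: Sprung2012, Lemma 2.3 (p. 1487); proof of Prop. 7.3 (p. 1500)]
[cite: GreenbergLNM1716, proof of Prop. 4.8 (p. 109)] -/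
theorem eq_zero_of_mem_localTowerPointsOfEmb_of_prime_nsmul (hp2 : p ≠ 2)
    (hgood : W.HasGoodReductionAtPrime p) (hap : (p : ℤ) ∣ W.frobeniusTrace p)
    (κ : ZpExtension ℚ p) (hpv : (p : 𝓞 ℚ) ∈ v.asIdeal)
    (ι : AlgebraicClosure ℚ →ₐ[ℚ] AlgebraicClosure (v.adicCompletion ℚ))
    {P : localPoints W (v.adicCompletion ℚ)} (hPmem : P ∈ localTowerPointsOfEmb κ ι W)
    (hpP : p • P = 0) : P = 0 := by
  have hp : p.Prime := Fact.out
  -- `V = E(ℚ_∞·ℚ_v)[p]`, a finite `Γ_{ℚ_v}`-stable subgroup of `E(K̄_v)`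
  set V : AddSubgroup (localPoints W (v.adicCompletion ℚ)) :=
    localTowerPointsOfEmb κ ι W ⊓ (localPoints W (v.adicCompletion ℚ))[(p : ℕ)] with hV
  have hpne : ((p : ℕ) : AlgebraicClosure (v.adicCompletion ℚ)) ≠ 0 := by
    haveI : CharZero (v.adicCompletion ℚ) :=
      charZero_of_injective_algebraMap (algebraMap ℚ _).injective
    exact_mod_cast hp.ne_zero
  have hcard : Nat.card ((localPoints W (v.adicCompletion ℚ))[(p : ℕ)]) = p ^ 2 :=
    WeierstrassCurve.card_torsionPoints_eq_sq_holds W (AlgebraicClosure (v.adicCompletion ℚ))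
      (n := p) hpne
  have hfinp : Finite ↥((localPoints W (v.adicCompletion ℚ))[(p : ℕ)]) :=
    Nat.finite_of_card_ne_zero (by rw [hcard]; exact pow_ne_zero 2 hp.ne_zero)
  haveI hVfin : Finite V :=
    Finite.of_injective _ (AddSubgroup.inclusion_injective (inf_le_right : V ≤ _))
  have hmemV : ∀ {x : localPoints W (v.adicCompletion ℚ)},
      x ∈ V ↔ x ∈ localTowerPointsOfEmb κ ι W ∧ p • x = 0 := by
    intro x
    rw [hV, AddSubgroup.mem_inf, AddSubgroup.torsionBy.nsmul_iff]
  have hstab : ∀ (σ : Field.absoluteGaloisGroup (v.adicCompletion ℚ))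
      (x : localPoints W (v.adicCompletion ℚ)), x ∈ V → σ • x ∈ V := by
    intro σ x hx
    rw [hmemV] at hx ⊢
    refine ⟨smul_mem_localTowerPointsOfEmb κ ι W σ hx.1, ?_⟩
    rw [smul_comm, hx.2, smul_zero]
  -- the permutation action `ρ : Γ_{ℚ_v} → Perm(V)`
  let ρ : Field.absoluteGaloisGroup (v.adicCompletion ℚ) →* Equiv.Perm V :=
    { toFun := fun σ ↦
        { toFun := fun x ↦ ⟨σ • (x : localPoints W (v.adicCompletion ℚ)), hstab σ _ x.2⟩
          invFun := fun x ↦ ⟨σ⁻¹ • (x : localPoints W (v.adicCompletion ℚ)), hstab σ⁻¹ _ x.2⟩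
          left_inv := fun x ↦
            Subtype.ext (inv_smul_smul σ (x : localPoints W (v.adicCompletion ℚ)))
          right_inv := fun x ↦
            Subtype.ext (smul_inv_smul σ (x : localPoints W (v.adicCompletion ℚ))) }
      map_one' := Equiv.ext fun x ↦
        Subtype.ext (one_smul _ (x : localPoints W (v.adicCompletion ℚ)))
      map_mul' := fun σ τ ↦ Equiv.ext fun x ↦
        Subtype.ext (mul_smul σ τ (x : localPoints W (v.adicCompletion ℚ))) }
  have hρ : ∀ (σ : Field.absoluteGaloisGroup (v.adicCompletion ℚ)) (x : V),
      ((ρ σ x : V) : localPoints W (v.adicCompletion ℚ)) =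
        σ • (x : localPoints W (v.adicCompletion ℚ)) := fun _ _ ↦ rfl
  -- `Gal(K̄_v/ℚ_∞·ℚ_v)` acts trivially (definition of the tower points): the range is a `p`-group
  have hker : localSubgroupOfEmb κ.kerSubgroup ι ≤ ρ.ker := by
    intro τ hτ
    rw [MonoidHom.mem_ker]
    refine Equiv.ext fun x ↦ Subtype.ext ?_
    rw [hρ, Equiv.Perm.coe_one, id_eq]
    exact (mem_localTowerPointsOfEmb_iff κ ι W _).mp (hmemV.mp x.2).1 τ hτ
  have hP : IsPGroup p ρ.range := κ.isPGroup_range_of_localSubgroupOfEmb_le ι ρ hker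
  -- fixed points of the range on `V`: exactly `{0}`
  have hfp : MulAction.fixedPoints ρ.range V = {(0 : V)} := by
    ext x
    simp only [Set.mem_singleton_iff, MulAction.mem_fixedPoints]
    constructor
    · intro hx
      have hall : ∀ σ : Field.absoluteGaloisGroup (v.adicCompletion ℚ),
          σ • (x : localPoints W (v.adicCompletion ℚ)) =
            (x : localPoints W (v.adicCompletion ℚ)) := fun σ ↦ by
        have h := hx ⟨ρ σ, MonoidHom.mem_range.mpr ⟨σ, rfl⟩⟩
        rw [Subgroup.mk_smul, Equiv.Perm.smul_def] at h
        have h' := congrArg (fun z : V ↦ (z : localPoints W (v.adicCompletion ℚ))) h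
        simpa only [hρ] using h'
      have hx0 : (x : localPoints W (v.adicCompletion ℚ)) = 0 :=
        localPoints_eq_zero_of_forall_smul_eq_of_prime_nsmul W p hp2 hgood hap hpv hall
          (hmemV.mp x.2).2
      exact Subtype.ext (by rw [hx0, ZeroMemClass.coe_zero])
    · rintro rfl ⟨π, hπ⟩
      obtain ⟨σ, rfl⟩ := MonoidHom.mem_range.mp hπ
      rw [Subgroup.mk_smul, Equiv.Perm.smul_def]
      exact Subtype.ext (by rw [hρ, ZeroMemClass.coe_zero, smul_zero])
  -- `#V ≡ 1 (mod p)`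
  have hmod : Nat.card V ≡ 1 [MOD p] := by
    have h := hP.card_modEq_card_fixedPoints V
    have h1 : Nat.card (({0} : Set V) : Type _) = 1 := Nat.card_unique
    rwa [hfp, h1] at h
  -- `#V` is a power of `p`
  have hPV : IsPGroup p (Multiplicative V) := fun g ↦ ⟨1, by
    rw [pow_one]
    change Multiplicative.ofAdd (p • (Multiplicative.toAdd g)) = Multiplicative.ofAdd 0
    congr 1
    exact Subtype.ext (by
      rw [AddSubmonoidClass.coe_nsmul, ZeroMemClass.coe_zero]
      exact (hmemV.mp (Multiplicative.toAdd g).2).2)⟩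
  obtain ⟨n, hn⟩ := IsPGroup.iff_card.mp hPV
  have hnV : Nat.card V = p ^ n := hn
  -- hence `n = 0` and `V` is trivial
  have hn0 : n = 0 := by
    by_contra hne
    have hdvd : p ∣ Nat.card V := hnV ▸ dvd_pow_self p hne
    have h : Nat.card V % p = 1 % p := hmod
    rw [Nat.mod_eq_zero_of_dvd hdvd, Nat.mod_eq_of_lt hp.one_lt] at h
    exact zero_ne_one h
  rw [hn0, pow_zero] at hnV
  haveI hsub : Subsingleton V := (Nat.card_eq_one_iff_unique.mp hnV).1
  -- the given point lies in `V`
  have hPV' : P ∈ V := hmemV.mpr ⟨hPmem, hpP⟩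
  have h := congrArg Subtype.val (Subsingleton.elim (⟨P, hPV'⟩ : V) ⟨0, V.zero_mem⟩)
  exact h

/-- **Sprung 2012, Lemma 2.3 — DISCHARGED** (`lem23_localTowerPoints_noPTorsion_holds`): for
`W/ℚ` elliptic and globally minimal, `p ≠ 2` of good supersingular reduction (`p ∣ a_p`), the
cyclotomic `κ` and the place `v ∋ p`, the group `E(ℚ_∞·ℚ_p) = localTowerPointsOfEmb κ ι W`
(`ι = closureEmb ℚ_v`) has no non-zero point killed by `p` ("`F_ss(k_n)` has no `p`-torsion",
p. 1487, with "`Ẽ(𝔽_p)` … no `p`-torsion, since `p` is supersingular", p. 1500; = [Sprung2024] p. 40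
"[64, Lemma 2.3]"): `eq_zero_of_mem_localTowerPointsOfEmb_of_prime_nsmul` at `ι = closureEmb ℚ_v`
(the hypothesis `κ.IsCyclotomic` is not needed).
[cite: Sprung2012, Lemma 2.3 (p. 1487); proof of Prop. 7.3 (p. 1500)]
[cite: GreenbergLNM1716, proof of Prop. 4.8 (p. 109)] -/
theorem lem23_localTowerPoints_noPTorsion_holds : lem23_localTowerPoints_noPTorsion :=
  fun W _ _ p _ hp2 hgood hap κ _ _ hpv _ hPmem hpP ↦
    eq_zero_of_mem_localTowerPointsOfEmb_of_prime_nsmul W p hp2 hgood hap κ hpv _ hPmem hpP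

end Literature.NumberTheory.EllipticCurves.Sprung2012

end
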